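import Mathlib
import Summits.Langlands.Langlands.Theorems.QuadraticWindowHostInducedRepInducedPackageAux
import Summits.Langlands.Langlands.Theorems.QuadraticWindowHostInducedRepSignedTwistAux
import Summits.Langlands.Langlands.Theorems.HostInducedRep.Negative.AsaiSignHazard
import Literature.NumberTheory.Automorphic.AsaiSign
import Literature.NumberTheory.Automorphic.BaseChangeInductionAlongProofs
import Literature.NumberTheory.Automorphic.AutomorphicRepsGLSatakeFlathProofs

/-!
# The automorphic package of line `one-transparent-pane` — stub `stub_package` of the crux
# `Summit.Langlands.Langlands.Theses.QuadraticWindow.HostInducedRep` (stmt-Langlands-10902):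
# helper file 5 — the induced Satake parameter of a `τ`-polarized `π` is polarized

LOG (worker `stub_package`, 2026-08-16; full log and inventory in helper file 1,
`QuadraticWindowHostInducedRepPackage.lean`).  FACT-FREE.

Setting: `F/F₀` quadratic with non-trivial automorphism `τ`, `π` an automorphic representation of
`GL_n(𝔸_F)`, `v` a finite place of `F₀` unramified in `F` above which `π` has Satake parameters
`α_w`, twisting scalars `c_w ≠ 0` (`w ∣ v`; on paper `c_w = eψ(Frob_w) = ψ(ϖ_w)`), and the
polarization relation of the crux at the places over `v` with Frobenius value `cₑ` of the avatar `e`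
at `v` and weight `k`: `Sat(π, τ•w) = Sat(π, w)⁻¹ · (cₑ q_v^k)^{f(w∣v)}`.  Let `B` be the induced
Satake parameter at `v` of the twisted family, `∏_{b ∈ B} (X - b) = ∏_{w ∣ v} ∏_{a ∈ α_w c_w} (X^{f(w∣v)} - a)`
(the relation `IsInducedPackage` of the induced package `Π = AI_{F/F₀}(π ⊗ ψ)`).

Statement (`inducedParam_map_inv`): `B⁻¹ = B · θ_v` with `θ_v = (cₑ q_v^k ∏_{w ∣ v} c_w)⁻¹` — the
value at `ϖ_v` of the inverse polarization character `θ = (χ_e ‖·‖^{-k} ψ|_{𝔸_{F₀}})⁻¹` of `π ⊗ ψ`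
(so `Π^∨ ≅ Π ⊗ θ` at the unramified level).  Proof: the fibre of `v` is `{w₀, τw₀}` with both residue
degrees `1` (split: `B = A + A'`, `A' = A⁻¹ · cₑ q^k c_{w₀} c_{τw₀}`) or `{w₀}` with residue degree `2`
(inert: `B` = the square roots of `A`, `A⁻¹ = A · s²`), by the tree's
`HeightOneSpectrum.eq_or_eq_smul_of_under_eq`, `inertiaDeg_eq_one_of_smul_ne`,
`inertiaDeg_eq_two_of_smul_eq_of_isUnramifiedIn`; then pure multiset algebra.  This is the
`Π`-level input of the a.e. conjugate self-duality of the member representation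
`τ' = BC_{K/F₀}(Π) ⊗ ψ₀`, whose remaining multiset algebra (base change to `K`: `map_pow_map_inv`;
the twist by `ψ₀` at conjugate resp. `c`-fixed places: `map_mul_eq_map_inv_of_mul_eq`,
`map_mul_eq_map_inv_self`; roots of `P(X^f)`: `satakePolynomial_map_mul_of_comp`,
`satakePolynomial_map_inv_of_comp`, `map_inv_eq_map_mul_of_comp`) is §4 below.
References: Arthur–Clozel, Ann. of Math. Stud. 120 (1989), Ch. 3 Def. 6.1, (6.1)–(6.2)
[ArthurClozelAMS120]; Cassels–Fröhlich, Ch. VII Prop. 1.2 [CasselsFrohlichANT1967]. [folklore]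
-/

open scoped BigOperators Polynomial Classical
open Polynomial IsDedekindDomain NumberField
open Literature.NumberTheory.Automorphic Literature.NumberTheory.GaloisRepresentations
open Summit.Langlands.Langlands.Theorems.HostInducedRep.GrsExplicitDescent
open Summit.Langlands.Langlands.Theorems.HostInducedRep.Negative

-- `Summit.Langlands.Langlands.…` (summit = sub-problem name, D-0017 layout) trips `dupNamespace`.
set_option linter.dupNamespace false

noncomputable section

namespace Summit.Langlands.Langlands.Theorems.HostInducedRep.OneTransparentPane

/-! ## §4 Multiset algebra of the conjugate self-duality `Sat(τ', c•u) = Sat(τ', u)⁻¹`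

The a.e. conjugate self-duality of `τ' = Π_K ⊗ ψ₀` is read off the Satake parameters: at the level
of `Π = AI(π')` the polarization `hpol` gives `B_v⁻¹ = B_v · θ(ϖ_v)` (split `v`: the two halves
`A`, `A⁻¹t` of the induced parameter; inert `v`: square roots), and base change to `K` raises to
`f(u∣v)`-th powers.  The lemmas below are the pure algebra of these steps. -/

section ConjSelfDual

open Multiset

/-- **Split place of `F`**: if `A' = A⁻¹ · t` (`t ≠ 0`) then the union `B = A + A'` satisfies
`B⁻¹ = B · t⁻¹`. [folklore] -/
theorem map_inv_add_of_eq_map_inv_mul {A A' : Multiset ℂ} {t : ℂ} (ht : t ≠ 0)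
    (h : A' = A.map (fun a ↦ a⁻¹ * t)) :
    (A + A').map (·⁻¹) = (A + A').map (· * t⁻¹) := by
  subst h
  rw [Multiset.map_add, Multiset.map_add, Multiset.map_map, Multiset.map_map, add_comm]
  congr 1
  · refine Multiset.map_congr rfl fun a _ ↦ ?_
    simp only [Function.comp_apply, mul_inv_rev, inv_inv]
    field_simp
  · refine Multiset.map_congr rfl fun a _ ↦ ?_
    simp only [Function.comp_apply]
    field_simp

/-- The `f`-th roots of `a`, multiplied by `t ≠ 0`, are the `f`-th roots of `t^f a`. [folklore] -/
theorem nthRoots_map_mul {t : ℂ} (ht : t ≠ 0) (f : ℕ) (hf : 0 < f) (a : ℂ) :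
    (Polynomial.nthRoots f a).map (· * t) = Polynomial.nthRoots f (t ^ f * a) := by
  have h1 : (Polynomial.nthRoots f a).map (· * t) =
      ((Polynomial.nthRoots f a).map (fun r ↦ (1 * r)⁻¹)).map (fun x ↦ (t⁻¹ * x)⁻¹) := by
    rw [Multiset.map_map]
    refine Multiset.map_congr rfl fun r _ ↦ ?_
    simp only [Function.comp_apply]
    field_simp
  rw [h1, nthRoots_map_inv_mul one_ne_zero f hf, nthRoots_map_inv_mul (inv_ne_zero ht) f hf]
  congr 1
  rw [one_pow, one_mul, inv_pow, mul_inv_rev, inv_inv, inv_inv, mul_comm]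

/-- **Roots of `P(X^f)`**: if `∏_{b ∈ B} (X - b) = (∏_{a ∈ A} (X - a))(X^f)` (`f ≥ 1`), then `B` is
the multiset of all `f`-th roots of the entries of `A`. [folklore] -/
theorem eq_bind_nthRoots_of_satakePolynomial_eq_comp {B A : Multiset ℂ} {f : ℕ} (hf : 0 < f)
    (h : satakePolynomial B = (satakePolynomial A).comp (X ^ f)) :
    B = A.bind (Polynomial.nthRoots f) := by
  have hl := congrArg Polynomial.roots h
  rw [roots_satakePolynomial, satakePolynomial_comp_X_pow, roots_multiset_prod] at hl
  · rw [hl, Multiset.bind_map]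
    rfl
  · rw [Multiset.mem_map]
    rintro ⟨a, -, ha⟩
    exact (monic_X_pow_sub_C a hf.ne').ne_zero ha

/-- The Satake polynomial of all `f`-th roots of the entries of `A` is `(∏_{a ∈ A} (X - a))(X^f)`.
[folklore] -/
theorem satakePolynomial_bind_nthRoots (A : Multiset ℂ) {f : ℕ} (hf : 0 < f) :
    satakePolynomial (A.bind (Polynomial.nthRoots f)) = (satakePolynomial A).comp (X ^ f) := by
  rw [satakePolynomial, satakePolynomial_comp_X_pow, Multiset.map_bind, Multiset.prod_bind]
  refine congrArg Multiset.prod (Multiset.map_congr rfl fun a _ ↦ ?_)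
  exact prod_nthRoots_X_sub_C f hf a

/-- **Powers transport multiplication**: if `B` is the multiset of `f`-th roots of `A`, then `B · t`
is the multiset of `f`-th roots of `A · t^f`. [folklore] -/
theorem satakePolynomial_map_mul_of_comp {B A : Multiset ℂ} {f : ℕ} (hf : 0 < f)
    (h : satakePolynomial B = (satakePolynomial A).comp (X ^ f)) {t : ℂ} (ht : t ≠ 0) :
    satakePolynomial (B.map (· * t)) = (satakePolynomial (A.map (· * t ^ f))).comp (X ^ f) := by
  classical
  rw [eq_bind_nthRoots_of_satakePolynomial_eq_comp hf h, Multiset.map_bind,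
    ← satakePolynomial_bind_nthRoots _ hf, Multiset.bind_map]
  congr 1
  refine Multiset.bind_congr fun a _ ↦ ?_
  rw [nthRoots_map_mul ht f hf, mul_comm]

/-- **Powers transport inversion**: if `B` is the multiset of `f`-th roots of `A`, then `B⁻¹` is the
multiset of `f`-th roots of `A⁻¹`. [folklore] -/
theorem satakePolynomial_map_inv_of_comp {B A : Multiset ℂ} {f : ℕ} (hf : 0 < f)
    (h : satakePolynomial B = (satakePolynomial A).comp (X ^ f)) :
    satakePolynomial (B.map (·⁻¹)) = (satakePolynomial (A.map (·⁻¹))).comp (X ^ f) := by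
  classical
  rw [eq_bind_nthRoots_of_satakePolynomial_eq_comp hf h, Multiset.map_bind,
    ← satakePolynomial_bind_nthRoots _ hf, Multiset.bind_map]
  congr 1
  refine Multiset.bind_congr fun a _ ↦ ?_
  have := nthRoots_map_inv_mul (one_ne_zero (α := ℂ)) f hf a
  simp only [one_mul, one_pow] at this
  exact this

/-- Two multisets with the same Satake polynomial are equal (they are its roots). [folklore] -/
theorem eq_of_satakePolynomial_eq {B B' : Multiset ℂ} (h : satakePolynomial B = satakePolynomial B') :
    B = B' := by
  rw [← roots_satakePolynomial B, h, roots_satakePolynomial]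

/-- **Inert place (of `F`, or of `K`)**: if `B` is the multiset of `f`-th roots of `A` (`f ≥ 1`) and
`A⁻¹ = A · s^f`, then `B⁻¹ = B · s` — e.g. `f = 2`: a parameter made of both square roots of a
`±`-polarized multiset is itself polarized. [folklore] -/
theorem map_inv_eq_map_mul_of_comp {B A : Multiset ℂ} {f : ℕ} (hf : 0 < f)
    (h : satakePolynomial B = (satakePolynomial A).comp (X ^ f)) {s : ℂ} (hs : s ≠ 0)
    (hA : A.map (·⁻¹) = A.map (· * s ^ f)) : B.map (·⁻¹) = B.map (· * s) := by
  apply eq_of_satakePolynomial_eq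
  rw [satakePolynomial_map_inv_of_comp hf h, satakePolynomial_map_mul_of_comp hf h hs, hA]

/-- **Base change to `K` raises to powers**: if `B⁻¹ = B · θ` then `(B^f)⁻¹ = B^f · θ^f`. [folklore] -/
theorem map_pow_map_inv {B : Multiset ℂ} {θ : ℂ} (h : B.map (·⁻¹) = B.map (· * θ)) (f : ℕ) :
    (B.map (· ^ f)).map (·⁻¹) = (B.map (· ^ f)).map (· * θ ^ f) := by
  have h1 : (B.map (· ^ f)).map (·⁻¹) = (B.map (·⁻¹)).map (· ^ f) := by
    rw [Multiset.map_map, Multiset.map_map]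
    exact Multiset.map_congr rfl fun b _ ↦ by simp [inv_pow]
  have h2 : (B.map (· ^ f)).map (· * θ ^ f) = (B.map (· * θ)).map (· ^ f) := by
    rw [Multiset.map_map, Multiset.map_map]
    exact Multiset.map_congr rfl fun b _ ↦ by simp [mul_pow]
  rw [h1, h2, h]

/-- **The twisted parameter at a pair of conjugate places** (`u ≠ c•u` over `v` split in `K`):
if `B⁻¹ = B · θ` and `s · s' = θ` (`s = ψ₀(ϖ_u)`, `s' = ψ₀(ϖ_{cu})`, `s ≠ 0`), then
`(B · s')` is the inverse of `(B · s)`. [folklore] -/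
theorem map_mul_eq_map_inv_of_mul_eq {B : Multiset ℂ} {θ s s' : ℂ} (h : B.map (·⁻¹) = B.map (· * θ))
    (hs : s ≠ 0) (hss' : s * s' = θ) : B.map (· * s') = (B.map (· * s)).map (·⁻¹) := by
  rw [Multiset.map_map]
  have : B.map (· * s') = (B.map (· * θ)).map (· * s⁻¹) := by
    rw [Multiset.map_map]
    refine Multiset.map_congr rfl fun b _ ↦ ?_
    simp only [Function.comp_apply, ← hss']
    field_simp
  rw [this, ← h, Multiset.map_map]
  refine Multiset.map_congr rfl fun b _ ↦ ?_
  simp only [Function.comp_apply, mul_inv_rev, mul_comm]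

/-- **The twisted parameter at a `c`-fixed place** (`u = c•u` over `v` inert in `K`, `f = 2`):
if `(B²)⁻¹ = B² · θ²` and `s² = θ²` (`s = ψ₀(ϖ_u) = ±θ(ϖ_v)`), then `B² · s` is self-inverse.
[folklore] -/
theorem map_mul_eq_map_inv_self {B₂ : Multiset ℂ} {θ s : ℂ} (h : B₂.map (·⁻¹) = B₂.map (· * θ ^ 2))
    (hs : s ≠ 0) (hss : s ^ 2 = θ ^ 2) : (B₂.map (· * s)).map (·⁻¹) = B₂.map (· * s) := by
  rw [Multiset.map_map]
  have : B₂.map (· * s) = (B₂.map (· * θ ^ 2)).map (· * s⁻¹) := by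
    rw [Multiset.map_map, ← hss]
    refine Multiset.map_congr rfl fun b _ ↦ ?_
    simp only [Function.comp_apply]
    field_simp
  rw [this, ← h, Multiset.map_map]
  refine Multiset.map_congr rfl fun b _ ↦ ?_
  simp only [Function.comp_apply, mul_inv_rev, mul_comm]

end ConjSelfDual



section Polar

variable {F₀ F : Type} [Field F₀] [NumberField F₀] [Field F] [NumberField F] [Algebra F₀ F]
variable {n : ℕ} {hcpt : isCompact_glFiniteIntegralLevel n F}

/-- **The induced Satake parameter of a `τ`-polarized representation is polarized.**  With the
data of the module docstring (`v` unramified in `F`, Satake parameters `α_w` of `π` above `v`,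
scalars `c_w ≠ 0`, the polarization relation at the places over `v` with `cₑ q_v^k ≠ 0`, and `B`
the induced parameter of the twisted family `(α_w c_w)_w`):
`B⁻¹ = B · (cₑ q_v^k ∏_{w ∣ v} c_w)⁻¹`. [folklore] -/
theorem inducedParam_map_inv (hdeg : Module.finrank F₀ F = 2) (τ : F ≃ₐ[F₀] F) (hτ : τ ≠ 1)
    (π : AutomorphicRepData (AutomorphyDatum.gl n F hcpt)) (k : ℤ)
    {v : HeightOneSpectrum (𝓞 F₀)} {α : HeightOneSpectrum (𝓞 F) → Multiset ℂ}
    {c : HeightOneSpectrum (𝓞 F) → ℂ} {cₑ : ℂ}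
    (hram : ∀ w : HeightOneSpectrum (𝓞 F), w.under (𝓞 F₀) = v → w.asIdeal.ramificationIdx (𝓞 F₀) = 1)
    (hsat : ∀ w : HeightOneSpectrum (𝓞 F), w.under (𝓞 F₀) = v → π.HasSatakeParamAt w (α w))
    (hc : ∀ w : HeightOneSpectrum (𝓞 F), w.under (𝓞 F₀) = v → c w ≠ 0)
    (hce : cₑ * (v.residueCard : ℂ) ^ k ≠ 0)
    (hpolv : ∀ w : HeightOneSpectrum (𝓞 F), w.under (𝓞 F₀) = v → ∀ β : Multiset ℂ,
      π.HasSatakeParamAt (τ • w) β →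
        β = (α w).map (fun a ↦ a⁻¹ * (cₑ * (v.residueCard : ℂ) ^ k) ^ w.asIdeal.inertiaDeg (𝓞 F₀)))
    {B : Multiset ℂ}
    (hB : satakePolynomial B = inducedSatakePolynomial v (fun w ↦ (α w).map (· * c w))) :
    B.map (·⁻¹) = B.map (· * (cₑ * (v.residueCard : ℂ) ^ k *
      ∏ᶠ w ∈ {w : HeightOneSpectrum (𝓞 F) | w.under (𝓞 F₀) = v}, c w)⁻¹) := by
  classical
  set t : ℂ := cₑ * (v.residueCard : ℂ) ^ k with ht
  obtain ⟨w₀, hw₀⟩ := HeightOneSpectrum.exists_under_eq F v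
  have hτw₀ : (τ • w₀).under (𝓞 F₀) = v := by
    rw [HeightOneSpectrum.under_algEquiv_smul F₀ F τ w₀, hw₀]
  -- the fibre of `v`
  have hfib : ∀ w : HeightOneSpectrum (𝓞 F), w.under (𝓞 F₀) = v → w = w₀ ∨ w = τ • w₀ := fun w hw ↦
    HeightOneSpectrum.eq_or_eq_smul_of_under_eq hdeg hτ (hw.trans hw₀.symm)
  by_cases hfix : τ • w₀ = w₀
  · -- INERT: fibre `{w₀}`, residue degree `2`
    have hset : {w : HeightOneSpectrum (𝓞 F) | w.under (𝓞 F₀) = v} = {w₀} := by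
      ext w
      simp only [Set.mem_setOf_eq, Set.mem_singleton_iff]
      refine ⟨fun hw ↦ ?_, fun hw ↦ hw ▸ hw₀⟩
      rcases hfib w hw with h | h
      · exact h
      · rw [h, hfix]
    have hset' : {w : HeightOneSpectrum (𝓞 F) | w.asIdeal.under (𝓞 F₀) = v.asIdeal} = {w₀} := by
      rw [← hset]; ext w; exact (place_under_eq_iff_asIdeal w v).symm
    have hunr : Algebra.IsUnramifiedIn (𝓞 F) (w₀.under (𝓞 F₀)).asIdeal := by
      rw [hw₀]; exact isUnramifiedIn_of_forall_ramificationIdx_eq_one v hram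
    have hf2 : w₀.asIdeal.inertiaDeg (𝓞 F₀) = 2 :=
      inertiaDeg_eq_two_of_smul_eq_of_isUnramifiedIn hdeg hτ hfix hunr
    -- `B` = square roots of `A = α_{w₀} c_{w₀}`
    have hB' : satakePolynomial B = (satakePolynomial ((α w₀).map (· * c w₀))).comp (X ^ 2) := by
      rw [hB, inducedSatakePolynomial, hset', finprod_mem_singleton, hf2]
    -- the polarization at `w₀`: `α = α⁻¹ t²`
    have hα : α w₀ = (α w₀).map (fun a ↦ a⁻¹ * t ^ 2) := by
      have h := hpolv w₀ hw₀ (α w₀) (hfix.symm ▸ hsat w₀ hw₀)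
      rwa [hf2] at h
    have hc₀ := hc w₀ hw₀
    have hA : ((α w₀).map (· * c w₀)).map (·⁻¹) = ((α w₀).map (· * c w₀)).map (· * ((t * c w₀)⁻¹) ^ 2) := by
      conv_lhs => rw [hα]
      rw [Multiset.map_map, Multiset.map_map, Multiset.map_map]
      refine Multiset.map_congr rfl fun a _ ↦ ?_
      simp only [Function.comp_apply]
      field_simp
    rw [hset, finprod_mem_singleton, show cₑ * (v.residueCard : ℂ) ^ k * c w₀ = t * c w₀ by rw [ht]]
    exact map_inv_eq_map_mul_of_comp two_pos hB' (inv_ne_zero (mul_ne_zero hce hc₀)) hA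
  · -- SPLIT: fibre `{w₀, τ w₀}`, residue degrees `1`
    have hne : w₀ ≠ τ • w₀ := fun h ↦ hfix h.symm
    have hset : {w : HeightOneSpectrum (𝓞 F) | w.under (𝓞 F₀) = v} = {w₀, τ • w₀} := by
      ext w
      simp only [Set.mem_setOf_eq, Set.mem_insert_iff, Set.mem_singleton_iff]
      refine ⟨fun hw ↦ hfib w hw, ?_⟩
      rintro (rfl | rfl)
      · exact hw₀
      · exact hτw₀
    have hset' : {w : HeightOneSpectrum (𝓞 F) | w.asIdeal.under (𝓞 F₀) = v.asIdeal} = {w₀, τ • w₀} := by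
      rw [← hset]; ext w; exact (place_under_eq_iff_asIdeal w v).symm
    have hf1 : w₀.asIdeal.inertiaDeg (𝓞 F₀) = 1 := by
      refine HeightOneSpectrum.inertiaDeg_eq_one_of_smul_ne hdeg (c := τ) ?_
      exact fun h ↦ hfix h
    have hf1' : (τ • w₀).asIdeal.inertiaDeg (𝓞 F₀) = 1 := by
      refine HeightOneSpectrum.inertiaDeg_eq_one_of_smul_ne hdeg (c := τ) ?_
      rw [HeightOneSpectrum.smul_smul_of_mul_self_eq_one
        (AlgEquiv.mul_self_eq_one_of_finrank_eq_two hdeg τ)]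
      exact fun h ↦ hfix h.symm
    set A : Multiset ℂ := (α w₀).map (· * c w₀) with hAdef
    set A' : Multiset ℂ := (α (τ • w₀)).map (· * c (τ • w₀)) with hA'def
    -- `B = A + A'`
    have hBAA : B = A + A' := by
      apply eq_of_satakePolynomial_eq
      rw [hB, inducedSatakePolynomial, hset', finprod_mem_pair hne, hf1, hf1', pow_one, comp_X, comp_X,
        satakePolynomial_add]
    -- the polarization at `w₀`: `α_{τ w₀} = α_{w₀}⁻¹ t`
    have hα : α (τ • w₀) = (α w₀).map (fun a ↦ a⁻¹ * t) := by
      have h := hpolv w₀ hw₀ (α (τ • w₀)) (hsat _ hτw₀)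
      rwa [hf1, pow_one] at h
    have hc₀ := hc w₀ hw₀
    have hA' : A' = A.map (fun x ↦ x⁻¹ * (t * c w₀ * c (τ • w₀))) := by
      rw [hA'def, hAdef, hα, Multiset.map_map, Multiset.map_map]
      refine Multiset.map_congr rfl fun a _ ↦ ?_
      simp only [Function.comp_apply]
      field_simp
    rw [hset, finprod_mem_pair hne, hBAA,
      show cₑ * (v.residueCard : ℂ) ^ k * (c w₀ * c (τ • w₀)) = t * c w₀ * c (τ • w₀) by rw [ht]; ring]
    exact map_inv_add_of_eq_map_inv_mul (mul_ne_zero (mul_ne_zero hce hc₀) (hc _ hτw₀)) hA'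

end Polar

/-- **Registered anchor** of this helper file (stub registry of stmt-Langlands-10902, line
`one-transparent-pane`, package helper "Polar"): base change raises a polarization to powers
(`map_pow_map_inv`). [folklore] -/
theorem packagePolar_anchor : ∀ (B : Multiset ℂ) (θ : ℂ), B.map (·⁻¹) = B.map (· * θ) → ∀ (f : ℕ), (B.map (· ^ f)).map (·⁻¹) = (B.map (· ^ f)).map (· * θ ^ f) :=
  fun _ _ h f ↦ map_pow_map_inv h f

end Summit.Langlands.Langlands.Theorems.HostInducedRep.OneTransparentPane

end
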